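import Literature.NumberTheory.Sieve.SmoothParitySievedSmall
import Literature.NumberTheory.Sieve.SmoothParitySievedTail
import HarnessLib

/-!
# The sieved lower bound for parity-class friable ternary counts

Topic `Literature/NumberTheory/Sieve`, namespace `Literature.NumberTheory.Sieve.SmoothArcs`; a PROVED file ([Harper2016, §5],
[LagariasSoundararajan2012, Thm 1.3]): the circle-method engine `parityTernary_asymptotic` turned into a LOWER BOUND for the
weighted count of `y`-friable solutions of `d₁n₁ + σd₂n₂ = n₃` (`n₁, n₂` odd) from which the solutions with a common odd
prime `3 ≤ p ≤ y` of `n₁, n₂, n₃` have been removed by the union bound (Bonferroni):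

`re W(X₁, X₂, X₃) − Σ_{3 ≤ p ≤ y prime} re W(X₁/p, X₂/p, X₃/p) ≥ (b₁ − a₁)(b₂ − a₂)/50 · Mv₁Mv₂Mv₃/X₃`

(`parityTernary_sieved_lower`), in the polylog regime `y = ⌊(log x)^{100000}⌋` (`x → ∞` through the naturals), `X_i = x/e_i`,
`Mv_i = e_i^{−α} x^α ζ(α,y)/√(2πφ₂(α,y))`, `α = α(x, y)`, for REAL NONNEGATIVE PLATEAU profiles (`p_{c_i} = 1` on `[a_i, b_i]`,
`= 0` below `1/4`, `|p| ≤ 1`, Lipschitz) whose cores are compatible with the equation, bounded scalings `e_i ≤ E₀` and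
dilations `d₁` even, `d₂` odd, `d_i ≤ D₀`, `d₁d₂ ∣ 2^k`, `d₁/e₁ + d₂/e₂ + 1/e₃ ≤ 1`, given the GRH-type currency for
non-principal friable character sums (`hF`) and the long-range decay of `ζ(α+it, y)/ζ(α, y)` (`hD`).

Proof: `parityTernary_sieved_small` (main term `re 𝔖 · re MC ≥ 0.249 · 0.81 (b₁−a₁)(b₂−a₂) Q`, small primes
`p ≤ (log x)^{180}` by the same asymptotic at the scalings `e_i p` and `Σ p^{1−3α} ≤ 0.501`) and
`parityTernary_sieved_tail` (large primes by Harper's crude Hölder count, total `o(Q)`).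

## References

* A. J. Harper, Compositio Math. 152 (2016), §5 [Harper2016].
* J. C. Lagarias, K. Soundararajan, Proc. LMS 104 (2012), Thm 1.3 [LagariasSoundararajan2012].
-/

noncomputable section

open Finset Real Complex Filter Topology

namespace Literature.NumberTheory.Sieve

namespace SmoothArcs

open TwistedWeight

set_option maxHeartbeats 1600000 in
/-- **THE SIEVED LOWER BOUND FOR PARITY-CLASS FRIABLE TERNARY COUNTS.**  See the module docstring: in the polylog regime
`y = ⌊(log x)^{100000}⌋`, for real nonnegative compatible plateau profiles and bounded data, for all large natural `x`,
`(b₁−a₁)(b₂−a₂)/50 · Mv₁Mv₂Mv₃/(x/e₃) ≤ re W(x/e_i) − Σ_{3 ≤ p ≤ y prime} re W(x/(e_ip))`.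
[cite: Harper2016, §5] [cite: LagariasSoundararajan2012, Thm 1.3 (shape)] -/
theorem parityTernary_sieved_lower
    (hF : ∀ ε : ℝ, 0 < ε → ∃ C : ℝ, 0 < C ∧ ∀ (q : ℕ) (χ : DirichletCharacter ℂ q), q ≠ 0 → χ ≠ 1 →
      ∀ (y : ℕ) (X lam : ℝ), 1 ≤ X →
        ‖∑ n ∈ Nat.smoothNumbersUpTo ⌊X⌋₊ (y + 1), χ (n : ZMod q) * twistWeight lam (n / X)‖ ≤
          C * (1 + |lam|) ^ 3 * X ^ (1 / 2 + ε) * (q : ℝ) ^ ε)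
    (hD : FriableZetaLongRangeDecay) (D₀ E₀ : ℕ) {L a₁ b₁ a₂ b₂ a₃ b₃ : ℝ} {c₁ c₂ c₃ : ℤ → ℂ}
    (hc₁ : Summable (fun ℓ : ℤ => ‖c₁ ℓ‖ * (1 + |(ℓ : ℝ)|) ^ 3)) (hc₂ : Summable (fun ℓ : ℤ => ‖c₂ ℓ‖ * (1 + |(ℓ : ℝ)|) ^ 3))
    (hc₃ : Summable (fun ℓ : ℤ => ‖c₃ ℓ‖ * (1 + |(ℓ : ℝ)|) ^ 3))
    (hre₁ : ∀ v : ℝ, (profileFn c₁ v).im = 0) (hre₂ : ∀ v : ℝ, (profileFn c₂ v).im = 0)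
    (hre₃ : ∀ v : ℝ, (profileFn c₃ v).im = 0)
    (hnn₁ : ∀ v : ℝ, 0 ≤ (profileFn c₁ v).re) (hnn₂ : ∀ v : ℝ, 0 ≤ (profileFn c₂ v).re)
    (hnn₃ : ∀ v : ℝ, 0 ≤ (profileFn c₃ v).re)
    (hle₁ : ∀ v : ℝ, ‖profileFn c₁ v‖ ≤ 1) (hle₂ : ∀ v : ℝ, ‖profileFn c₂ v‖ ≤ 1) (hle₃ : ∀ v : ℝ, ‖profileFn c₃ v‖ ≤ 1)
    (hz₁ : ∀ v : ℝ, v ≤ 1 / 4 → profileFn c₁ v = 0) (hz₂ : ∀ v : ℝ, v ≤ 1 / 4 → profileFn c₂ v = 0)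
    (hz₃ : ∀ v : ℝ, v ≤ 1 / 4 → profileFn c₃ v = 0)
    (hL : 0 ≤ L) (hL₁ : ∀ v w : ℝ, ‖profileFn c₁ v - profileFn c₁ w‖ ≤ L * |v - w|)
    (hL₂ : ∀ v w : ℝ, ‖profileFn c₂ v - profileFn c₂ w‖ ≤ L * |v - w|)
    (hL₃ : ∀ v w : ℝ, ‖profileFn c₃ v - profileFn c₃ w‖ ≤ L * |v - w|)
    (ha₁ : 0 < a₁) (hab₁ : a₁ < b₁) (hb₁ : b₁ ≤ 1) (ha₂ : 0 < a₂) (hab₂ : a₂ < b₂) (hb₂ : b₂ ≤ 1)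
    (ha₃ : 0 < a₃) (hab₃ : a₃ < b₃) (hb₃ : b₃ ≤ 1)
    (hp₁ : ∀ v ∈ Set.Icc a₁ b₁, profileFn c₁ v = 1) (hp₂ : ∀ v ∈ Set.Icc a₂ b₂, profileFn c₂ v = 1)
    (hp₃ : ∀ v ∈ Set.Icc a₃ b₃, profileFn c₃ v = 1) :
    ∀ᶠ x : ℕ in atTop, ∀ (σ : ℤ) (e₁ e₂ e₃ d₁ d₂ k : ℕ),
      (σ = 1 ∨ σ = -1) → 1 ≤ e₁ → 1 ≤ e₂ → 1 ≤ e₃ → e₁ ≤ E₀ → e₂ ≤ E₀ → e₃ ≤ E₀ →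
      1 ≤ d₁ → 1 ≤ d₂ → d₁ ≤ D₀ → d₂ ≤ D₀ → Even d₁ → Odd d₂ → d₁ * d₂ ∣ 2 ^ k →
      (d₁ : ℝ) / e₁ + d₂ / e₂ + 1 / e₃ ≤ 1 →
      (∀ n₁ n₂ : ℕ, a₁ * ((x : ℝ) / e₁) ≤ n₁ → (n₁ : ℝ) ≤ b₁ * ((x : ℝ) / e₁) → a₂ * ((x : ℝ) / e₂) ≤ n₂ → (n₂ : ℝ) ≤ b₂ * ((x : ℝ) / e₂) →
          a₃ * ((x : ℝ) / e₃) ≤ (d₁ * n₁ : ℝ) + σ * (d₂ * n₂) ∧ (d₁ * n₁ : ℝ) + σ * (d₂ * n₂) ≤ b₃ * ((x : ℝ) / e₃)) →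
      (b₁ - a₁) * (b₂ - a₂) / 50 *
          (((e₁ : ℝ) ^ (-saddlePoint (x : ℝ) ⌊Real.log (x : ℝ) ^ 100000⌋₊) * ((x : ℝ) ^ saddlePoint (x : ℝ) ⌊Real.log (x : ℝ) ^ 100000⌋₊ * smoothZeta (saddlePoint (x : ℝ) ⌊Real.log (x : ℝ) ^ 100000⌋₊) ⌊Real.log (x : ℝ) ^ 100000⌋₊ / Real.sqrt (2 * Real.pi * saddlePhi₂ (saddlePoint (x : ℝ) ⌊Real.log (x : ℝ) ^ 100000⌋₊) ⌊Real.log (x : ℝ) ^ 100000⌋₊))) *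
            ((e₂ : ℝ) ^ (-saddlePoint (x : ℝ) ⌊Real.log (x : ℝ) ^ 100000⌋₊) * ((x : ℝ) ^ saddlePoint (x : ℝ) ⌊Real.log (x : ℝ) ^ 100000⌋₊ * smoothZeta (saddlePoint (x : ℝ) ⌊Real.log (x : ℝ) ^ 100000⌋₊) ⌊Real.log (x : ℝ) ^ 100000⌋₊ / Real.sqrt (2 * Real.pi * saddlePhi₂ (saddlePoint (x : ℝ) ⌊Real.log (x : ℝ) ^ 100000⌋₊) ⌊Real.log (x : ℝ) ^ 100000⌋₊))) *
            ((e₃ : ℝ) ^ (-saddlePoint (x : ℝ) ⌊Real.log (x : ℝ) ^ 100000⌋₊) * ((x : ℝ) ^ saddlePoint (x : ℝ) ⌊Real.log (x : ℝ) ^ 100000⌋₊ * smoothZeta (saddlePoint (x : ℝ) ⌊Real.log (x : ℝ) ^ 100000⌋₊) ⌊Real.log (x : ℝ) ^ 100000⌋₊ / Real.sqrt (2 * Real.pi * saddlePhi₂ (saddlePoint (x : ℝ) ⌊Real.log (x : ℝ) ^ 100000⌋₊) ⌊Real.log (x : ℝ) ^ 100000⌋₊)))) / ((x : ℝ) / e₃)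 ≤
        (parityTernarySum ⌊Real.log (x : ℝ) ^ 100000⌋₊ σ d₁ d₂ ((x : ℝ) / e₁) ((x : ℝ) / e₂) ((x : ℝ) / e₃) c₁ c₂ c₃).re -
          ∑ p ∈ (Finset.range (⌊Real.log (x : ℝ) ^ 100000⌋₊ + 1)).filter (fun p => p.Prime ∧ 3 ≤ p),
            (parityTernarySum ⌊Real.log (x : ℝ) ^ 100000⌋₊ σ d₁ d₂ ((x : ℝ) / e₁ / p) ((x : ℝ) / e₂ / p) ((x : ℝ) / e₃ / p) c₁ c₂ c₃).re := by
  have hκ : 0 < (b₁ - a₁) * (b₂ - a₂) := mul_pos (sub_pos.2 hab₁) (sub_pos.2 hab₂)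
  have _h : a₃ < b₃ := hab₃
  have h1 := parityTernary_sieved_small hF hD D₀ E₀ hc₁ hc₂ hc₃ hre₁ hre₂ hre₃ hnn₁ hnn₂ hnn₃ hle₁ hle₂ hle₃ hz₁ hz₂ hz₃
    hL hL₁ hL₂ hL₃ ha₁ hab₁ hb₁ ha₂ hab₂ hb₂ ha₃ hb₃ hp₁ hp₂ hp₃
  have h2 := parityTernary_sieved_tail E₀ hle₁ hle₂ hle₃ (δ := 3 / 50 * ((b₁ - a₁) * (b₂ - a₂))) (by positivity)
  filter_upwards [tendsto_natCast_atTop_atTop.eventually h1, h2] with x h1 h2 σ e₁ e₂ e₃ d₁ d₂ k hσ he₁ he₂ he₃ heE₁ heE₂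
    heE₃ hd₁ hd₂ hdD₁ hdD₂ hd₁e hd₂o hdk hde hcomp
  have hs := h1 σ e₁ e₂ e₃ d₁ d₂ hσ he₁ he₂ he₃ heE₁ heE₂ heE₃ hd₁ hd₂ hdD₁ hdD₂ hd₁e hd₂o hde hcomp
  have ht := h2 σ e₁ e₂ e₃ d₁ d₂ k hσ he₁ he₂ he₃ heE₁ heE₂ heE₃ hdk hde
  clear h1 h2
  rw [← Finset.sum_filter_add_sum_filter_not ((Finset.range (⌊Real.log (x : ℝ) ^ 100000⌋₊ + 1)).filter (fun p => p.Prime ∧ 3 ≤ p))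
    (fun p : ℕ => (p : ℝ) ≤ Real.log (x : ℝ) ^ 180)]
  have hre : ∑ p ∈ ((Finset.range (⌊Real.log (x : ℝ) ^ 100000⌋₊ + 1)).filter (fun p => p.Prime ∧ 3 ≤ p)).filter (fun p : ℕ => ¬((p : ℝ) ≤ Real.log (x : ℝ) ^ 180)),
      (parityTernarySum ⌊Real.log (x : ℝ) ^ 100000⌋₊ σ d₁ d₂ ((x : ℝ) / e₁ / p) ((x : ℝ) / e₂ / p) ((x : ℝ) / e₃ / p) c₁ c₂ c₃).re ≤
      ∑ p ∈ ((Finset.range (⌊Real.log (x : ℝ) ^ 100000⌋₊ + 1)).filter (fun p => p.Prime ∧ 3 ≤ p)).filter (fun p : ℕ => ¬((p : ℝ) ≤ Real.log (x : ℝ) ^ 180)),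
        ‖parityTernarySum ⌊Real.log (x : ℝ) ^ 100000⌋₊ σ d₁ d₂ ((x : ℝ) / e₁ / p) ((x : ℝ) / e₂ / p) ((x : ℝ) / e₃ / p) c₁ c₂ c₃‖ :=
    Finset.sum_le_sum fun p _ => Complex.re_le_norm _
  rw [mul_div_assoc] at hs ht ⊢
  linarith

end SmoothArcs

end Literature.NumberTheory.Sieve

end
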